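import Summits.AnomalousDissipation.AnomalousDissipation.Theorems.WindLineWindLineReachesCalm
import Summits.AnomalousDissipation.AnomalousDissipation.Theorems.WindLineWindLineFeedsTarget
import Summits.AnomalousDissipation.AnomalousDissipation.Theorems.WindLineWindyShoreUniform

/-!
# Crux `CyclicWindLineLoud` (stmt-AnomalousDissipation-11415), line `birth`/registered — the a-priori (ν-DEPENDENT) core of
# stub `stub_boundedCalmStateFromShore`: a calm state in the far-shore component with energy `≤ 3/(4π²ν)²`

Helper file (`--supports stmt-AnomalousDissipation-11415`; it does NOT prove the registered stub, whose content is the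
ν-UNIFORM energy cap — the open reachability/energy bet of the line). Record of the stub-worker's audit of the stub
(lead wave 1, 2026-08-17; outcome `stub-blocked: none`), kept because it documents exactly where the stub's content lies:

1. Junk / degenerate readings of the registered signature — none found:
   * `galerkinSubspace S = {IsRealCoeff ∧ IsSolenoidalCoeff}` does NOT kill the mean mode; the wind clause
     `c 0 = s • !₂[1, √2, √3]` is compatible with reality (`conjVec` fixes the real vector), and
     `galerkinRHS S ν ĝ c 0 = 0` identically on the phase space (`galerkinRHS_apply_zero`: no Stokes damping,
     `Π₀ = id`, no mean output of the convection symbol, `ĝ 0 = 0`) — momentum is free, `V` imposes no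
     equation at `k = 0`.
   * `0 ∈ freqBall N` for every `N` (`zero_mem_freqBall`), so the wind clause pins `a 0`; `0 ∉ V` for `N ≥ 1`
     (`galerkinRHS S ν ĝ 0 = Π ĝ = ĝ ≠ 0` on the first shell).
   * `N = 0`: `freqBall 0 = {0}`, `V = ℝ·e`, the matrix holds with `E = 0`; `N = 1`: `freqBall 1 = {0, ±eᵢ}`, no
     triad inside, the calm slice of `V` is the single Stokes point `ĝ/(4π²ν)` of energy `3/(32π⁴ν²) → ∞`;
     both absorbed by `∀ᶠ N`. For `N ≥ 2` the calm equations are genuinely quadratic.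
   * `V` contains states of EVERY wind at every `(ν > 0, N)` (Browder continuum projects onto `[-Λ, Λ]`), so
     `∃ a ∈ V, wind a ≥ s₁` is never vacuous/false; for `s₁` beyond the large-wind uniqueness threshold
     `s_u(ν, N)` (`eq_of_galerkinRHS_eq_of_wind_ge` + a-priori wake bound) `a` is forced onto the far-shore arc,
     whose component is THE wind-line — no loophole in the choice of `a`.
   * lower bound: a calm steady state has energy `≥ (1/2 - 4π²ν√E)/(2π) ≈ 0.08` (first-shell balance), upper
     a-priori bound `≤ 3/(32π⁴ν²)`; neither decides `∃ E ∀ ν`.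
2. Honest proof route (PROVED below, 0 sorries): Browder continuation over the wind slab `[0, max s₁ 0]`
   gives, at EVERY `ν > 0` and EVERY `N`, a state `a ∈ V` of wind `≥ s₁` and a calm `c` in
   `connectedComponentIn V a` with `Σ‖c_k‖² ≤ (Σ_{k∈S}‖ĝ_k‖²)/(4π²ν)² ≤ 3/(16π⁴ν²)`
   (`exists_calm_in_component_of_wind_ge`, general `d`, `S`, `e`, no non-resonance / uniqueness needed;
   `calmStateFromShore_apriori`, the stub's matrix verbatim with `∀ ν ∀ N` and `E(ν) = 3/(4π²ν)²`).
   The registered stub is this statement with the quantifier order `∃ E ν₀ ∀ ν < ν₀` — it needs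
   `sup_ν E(ν) < ∞` for SOME calm state of the far-shore component, and the only energy information in the
   tree/Literature on zeros of `galerkinRHS` is the energy identity (Temam 1979 (1.30)), which is sharp at
   `N = 1` (`E = 3/(32π⁴ν²)`). Where it dies: no ν-independent Lyapunov/coercivity functional for the calm
   Galerkin field is known; the inviscid (`ν = 0`) shore family has no a-priori bound at all (card K2,
   `Theses.WindLine.InviscidWindyShore`, open), so the continuum cannot be run at `ν = 0` either.
3. Disproof route: would need, for every `E`, at arbitrarily small `ν` and infinitely many `N`, that EVERY calm
   state on the wind-line has energy `> E` — requires control of the wind-line of the `N`-mode truncation at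
   small `ν`; nothing in the tree (6 negatives of the summit: none on steady Galerkin states) or in print
   (Nagata1990 / Waleffe2003 / OkamotoShoji1993 are numerical continuations) gives it. Kit j001712 (K² = 6)
   saw 46 / 89 bounded calm crossings (⟨|U|²⟩ ≤ 34 / 60) at ν = 10⁻² / 10⁻³ — evidence for TRUE at one
   under-resolved N, no trend in N.
4. No existing named tree/Literature fact implies the stub (searched `lean search windLine|calm|boundedCalm`,
   `lean find steady|windy|Browder`: 0 relevant hits outside this crux; `Theses.WindLine.{WindLineAvoidsLaminar,
   InviscidWindyShore, CyclicWindLineLoud}` are open and none gives an energy cap on a calm crossing).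
   playbook: none fit (pattern reused: the tree's own `windLine_reaches_calm` Browder transport).

Nothing in this file restates the stub under its registered name; the theorems below are the provable
ν-DEPENDENT core (a-priori lemmas; they are NOT the stub). Sources: F. E. Browder (1960) / Solan–Solan (2023)
(tree `BrowderContinuation`, via `exists_isConnected_zeros_of_bilin_coercive`); R. Temam, *Navier–Stokes Equations*
(1979), Ch. II (1.29)–(1.30) (energy identity and a-priori bound); Bessel's inequality for the cyclic force.
-/

-- `Summit.<Summit>.<Problem>` is the tree's mandated summit-side namespace (CONVENTIONS §2); for this
-- single-conjunct summit the two coincide, so the duplicate is deliberate.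
set_option linter.dupNamespace false

noncomputable section

open scoped BigOperators InnerProductSpace ComplexConjugate
open Set Function Filter MeasureTheory

namespace Summit.AnomalousDissipation.AnomalousDissipation.Theorems.CyclicWindLineLoud.CalmFromShore

open Literature.Analysis.FunctionSpaces Literature.Analysis.FunctionSpaces.Torus
open Literature.Analysis.FluidPDE Literature.Analysis.FluidPDE.Torus
open Summit.AnomalousDissipation.AnomalousDissipation.Theorems.WindLineReachesCalm

variable {d : Type*} [Fintype d] {S : Finset (d → ℤ)}

/-! ## §1 A windy state of large wind and a calm state in its component (a-priori, ν-dependent energy) -/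

/-- **A windy state of prescribed large wind and a calm state in its component, with the a-priori
(ν-dependent) energy bound.** Let `S` be a finite symmetric frequency set containing the mean mode,
`g ∈ galerkinSubspace S` a force vector without mean mode, `e` ANY direction, `ν > 0`, and `V` the windy
steady Galerkin variety `{c ∈ galerkinSubspace S : c 0 ∈ ℝ e_ℂ, galerkinRHS S ν g c = 0}`. For every
`s₁` there are `a ∈ V` of wind `≥ s₁` and a CALM state `c` (`c 0 = 0`) in the connected component of `a`
in `V` with `Σ_k ‖c_k‖² ≤ (Σ_k ‖g_k‖²) / (4π²ν)²`. Proof: the Browder continuum of zeros of the parametrised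
calm field over the wind slab `[0, Λ]`, `Λ = max s₁ 0` (`exists_isConnected_zeros_of_bilin_coercive`, coercivity
off the `‖g‖₂/(4π²ν)`-ball from `sum_re_inner_galerkinRHS_le`), is a connected subset of `V` whose wind
projection is all of `[0, Λ]`; its points of wind `Λ` and `0` are `a` and `c`, and the energy of the calm `c`
is its wake energy, bounded by `sqrt_calmEnergy_le_of_galerkinRHS_eq_zero` (Temam 1979, Ch. II (1.30)).
No non-resonance of `e` and no uniqueness at large wind are needed. [folklore] -/
theorem exists_calm_in_component_of_wind_ge (hS : ∀ k ∈ S, -k ∈ S) (h0 : (0 : d → ℤ) ∈ S)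
    {g : ↥S → EuclideanSpace ℂ d} (hg : g ∈ galerkinSubspace S) (hg0 : g ⟨0, h0⟩ = 0)
    (e : EuclideanSpace ℝ d) {ν : ℝ} (hν : 0 < ν) {V : Set (↥S → EuclideanSpace ℂ d)}
    (hV : V = {c | c ∈ galerkinSubspace S ∧
      (∃ s : ℝ, ∀ k : ↥S, (k : d → ℤ) = 0 → c k = (s : ℂ) • EuclideanSpace.complexify e) ∧
      galerkinRHS S ν g c = 0}) (s₁ : ℝ) :
    ∃ a ∈ V, (∃ s : ℝ, s₁ ≤ s ∧
        ∀ k : ↥S, (k : d → ℤ) = 0 → a k = (s : ℂ) • EuclideanSpace.complexify e) ∧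
      ∃ c ∈ connectedComponentIn V a, (∀ k : ↥S, (k : d → ℤ) = 0 → c k = 0) ∧
        ∑ k : ↥S, ‖c k‖ ^ 2 ≤ (∑ k : ↥S, ‖g k‖ ^ 2) / (4 * Real.pi ^ 2 * ν) ^ 2 := by
  classical
  set E : EuclideanSpace ℂ d := EuclideanSpace.complexify e with hE
  have hVmem : ∀ x, x ∈ V ↔ x ∈ galerkinSubspace S ∧
      (∃ s : ℝ, x ⟨0, h0⟩ = (s : ℂ) • E) ∧ galerkinRHS S ν g x = 0 := by
    intro x
    rw [hV, mem_setOf_eq]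
    simp only [forall_coe_eq_zero_iff h0]
  -- the a-priori energy bound at a calm state of `V`
  have hEnergy : ∀ x ∈ V, x ⟨0, h0⟩ = 0 →
      ∑ k : ↥S, ‖x k‖ ^ 2 ≤ (∑ k : ↥S, ‖g k‖ ^ 2) / (4 * Real.pi ^ 2 * ν) ^ 2 := by
    intro x hx hx0
    obtain ⟨hxY, -, hxz⟩ := (hVmem x).1 hx
    have h := sqrt_calmEnergy_le_of_galerkinRHS_eq_zero hν hS h0 hg.1 hg0 hxY hxz
    have hcalm : ∑ k : ↥S, (if (k : d → ℤ) = 0 then 0 else ‖x k‖ ^ 2) = ∑ k : ↥S, ‖x k‖ ^ 2 := by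
      refine Finset.sum_congr rfl fun k _ => ?_
      split_ifs with hk
      · have hk' : k = ⟨0, h0⟩ := Subtype.ext hk
        rw [hk', hx0, norm_zero]
        ring
      · rfl
    rw [hcalm] at h
    have hR : 0 ≤ Real.sqrt (∑ k : ↥S, ‖g k‖ ^ 2) / (4 * Real.pi ^ 2 * ν) := by positivity
    have h2 := (Real.sqrt_le_left hR).1 h
    rwa [div_pow, Real.sq_sqrt (Finset.sum_nonneg fun k _ => sq_nonneg _)] at h2
  -- a-priori radius of the wakes of windy steady states
  set ρ : ℝ := Real.sqrt (∑ k : ↥S, ‖g k‖ ^ 2) / (4 * Real.pi ^ 2 * ν) with hρ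
  have hρ0 : 0 ≤ ρ := by positivity
  -- the calm subspace `W`, its `ℓ²` form, and the wind direction vector
  set Y := galerkinSubspace S with hY
  set W : Submodule ℝ (↥S → EuclideanSpace ℂ d) :=
    Y ⊓ LinearMap.ker (LinearMap.proj (⟨0, h0⟩ : ↥S) :
      (↥S → EuclideanSpace ℂ d) →ₗ[ℝ] EuclideanSpace ℂ d) with hW
  have hWmem : ∀ x, x ∈ W ↔ x ∈ Y ∧ x ⟨0, h0⟩ = 0 := by
    intro x
    rw [hW, Submodule.mem_inf, LinearMap.mem_ker, LinearMap.proj_apply]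
  obtain ⟨B₀, hB₀⟩ : ∃ B₀ : (↥S → EuclideanSpace ℂ d) →ₗ[ℝ] (↥S → EuclideanSpace ℂ d) →ₗ[ℝ] ℝ,
      ∀ x y, B₀ x y = ∑ k : ↥S, (inner ℂ (x k) (y k)).re :=
    ⟨LinearMap.mk₂ ℝ (fun x y => ∑ k : ↥S, (inner ℂ (x k) (y k)).re)
      (fun x₁ x₂ y => by
        simp only [Pi.add_apply, inner_add_left, Complex.add_re, Finset.sum_add_distrib])
      (fun a x y => by
        simp only [Pi.smul_apply, real_smul_eq_coe_smul, inner_smul_left, Complex.conj_ofReal,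
          Complex.re_ofReal_mul, Finset.mul_sum, smul_eq_mul])
      (fun x y₁ y₂ => by
        simp only [Pi.add_apply, inner_add_right, Complex.add_re, Finset.sum_add_distrib])
      (fun a x y => by
        simp only [Pi.smul_apply, real_smul_eq_coe_smul, inner_smul_right, Complex.re_ofReal_mul,
          Finset.mul_sum, smul_eq_mul]),
      fun _ _ => rfl⟩
  obtain ⟨B, hB_apply⟩ : ∃ B : W →ₗ[ℝ] W →ₗ[ℝ] ℝ, ∀ x y : W, B x y =
      ∑ k : ↥S, (inner ℂ ((x : ↥S → EuclideanSpace ℂ d) k) ((y : ↥S → EuclideanSpace ℂ d) k)).re :=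
    ⟨B₀.compl₁₂ W.subtype W.subtype, fun x y => hB₀ _ _⟩
  have hB_self : ∀ x : W, B x x = ∑ k : ↥S, ‖(x : ↥S → EuclideanSpace ℂ d) k‖ ^ 2 := by
    intro x
    rw [hB_apply]
    refine Finset.sum_congr rfl fun k _ => ?_
    rw [← RCLike.re_to_complex, inner_self_eq_norm_sq]
  have hB_pos : ∀ x : W, x ≠ 0 → 0 < B x x := by
    intro x hx
    rw [hB_self]
    have hx' : (x : ↥S → EuclideanSpace ℂ d) ≠ 0 := fun h => hx (Subtype.ext h)
    obtain ⟨k, hk⟩ : ∃ k, (x : ↥S → EuclideanSpace ℂ d) k ≠ 0 := Function.ne_iff.1 hx'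
    exact lt_of_lt_of_le (pow_pos (norm_pos_iff.2 hk) 2)
      (Finset.single_le_sum (f := fun k => ‖(x : ↥S → EuclideanSpace ℂ d) k‖ ^ 2)
        (fun k _ => sq_nonneg _) (Finset.mem_univ k))
  set eh : ↥S → EuclideanSpace ℂ d := Pi.single (⟨0, h0⟩ : ↥S) E with heh
  have hehY : eh ∈ Y := single_complexify_mem_galerkinSubspace h0 e
  -- the affine embedding of `ℝ × W` onto the windy phase space
  set emb : ℝ → W → (↥S → EuclideanSpace ℂ d) := fun s x => (x : ↥S → EuclideanSpace ℂ d) + s • eh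
    with hemb
  have hembY : ∀ s x, emb s x ∈ Y := fun s x => Y.add_mem ((hWmem x).1 x.2).1 (Y.smul_mem s hehY)
  have hemb0 : ∀ s x, emb s x ⟨0, h0⟩ = (s : ℂ) • E := by
    intro s x
    rw [hemb]
    dsimp only
    rw [Pi.add_apply, ((hWmem x).1 x.2).2, zero_add, Pi.smul_apply, heh, Pi.single_eq_same,
      real_smul_eq_coe_smul]
  have hemb_ne : ∀ s x (k : ↥S), (k : d → ℤ) ≠ 0 → emb s x k = (x : ↥S → EuclideanSpace ℂ d) k := by
    intro s x k hk
    have hk' : k ≠ ⟨0, h0⟩ := fun h => hk (by rw [h])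
    rw [hemb]
    dsimp only
    rw [Pi.add_apply, Pi.smul_apply, heh, Pi.single_eq_of_ne hk', smul_zero, add_zero]
  have hembc : Continuous fun p : ℝ × W => emb p.1 p.2 :=
    (continuous_subtype_val.comp continuous_snd).add (continuous_fst.smul continuous_const)
  have hembV : ∀ s x, galerkinRHS S ν g (emb s x) = 0 → emb s x ∈ V := fun s x hz =>
    (hVmem _).2 ⟨hembY s x, ⟨s, hemb0 s x⟩, hz⟩
  -- the parametrised calm field and its coercivity off the `ρ`-ball, uniformly in the wind
  have hRHS_W : ∀ s x, galerkinRHS S ν g (emb s x) ∈ W := fun s x =>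
    (hWmem _).2 ⟨galerkinRHS_mem ν hS hg.1 (hembY s x),
      galerkinRHS_apply_zero ν h0 hg0 (hembY s x).2⟩
  set Vf : ℝ → W → W := fun s x => ⟨galerkinRHS S ν g (emb s x), hRHS_W s x⟩ with hVf
  have hVfc : Continuous fun p : ℝ × W => Vf p.1 p.2 :=
    Continuous.subtype_mk ((continuous_galerkinRHS ν).comp (continuous_const.prodMk hembc)) _
  have hcoer : ∀ (s : ℝ) (x : W), ρ ^ 2 ≤ B x x → B (Vf s x) x ≤ 0 := by
    intro s x hx
    have hsum : B (Vf s x) x = ∑ k : ↥S, (inner ℂ (emb s x k) (galerkinRHS S ν g (emb s x) k)).re := by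
      rw [hB_apply]
      refine Finset.sum_congr rfl fun k _ => ?_
      by_cases hk : (k : d → ℤ) = 0
      · have hk' : k = ⟨0, h0⟩ := Subtype.ext hk
        rw [hk']
        show (inner ℂ (galerkinRHS S ν g (emb s x) ⟨0, h0⟩) _).re = _
        rw [galerkinRHS_apply_zero ν h0 hg0 (hembY s x).2, inner_zero_left, inner_zero_right]
      · rw [← hemb_ne s x k hk, ← inner_conj_symm, Complex.conj_re]
    have hβ : ∑ k : ↥S, (if (k : d → ℤ) = 0 then 0 else ‖emb s x k‖ ^ 2) = B x x := by
      rw [hB_self]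
      refine Finset.sum_congr rfl fun k _ => ?_
      split_ifs with hk
      · have hk' : k = ⟨0, h0⟩ := Subtype.ext hk
        rw [hk', ((hWmem x).1 x.2).2, norm_zero]
        ring
      · rw [hemb_ne s x k hk]
    have hle := sum_re_inner_galerkinRHS_le hν.le hS h0 hg.1 hg0 (hembY s x)
    rw [hβ, ← hsum] at hle
    have hb0 : 0 ≤ B x x := (sq_nonneg ρ).trans hx
    have hsq : ρ ≤ Real.sqrt (B x x) := by
      rw [← Real.sqrt_sq hρ0]
      exact Real.sqrt_le_sqrt hx
    have hγ : Real.sqrt (∑ k : ↥S, ‖g k‖ ^ 2) = 4 * Real.pi ^ 2 * ν * ρ := by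
      rw [hρ]
      field_simp
    rw [hγ] at hle
    have h1 : 4 * Real.pi ^ 2 * ν * ρ * Real.sqrt (B x x) ≤
        4 * Real.pi ^ 2 * ν * (Real.sqrt (B x x) * Real.sqrt (B x x)) := by
      rw [mul_assoc]
      exact mul_le_mul_of_nonneg_left (mul_le_mul_of_nonneg_right hsq (Real.sqrt_nonneg _))
        (by positivity)
    rw [Real.mul_self_sqrt hb0] at h1
    linarith
  -- Browder continuation over the wind slab `[0, Λ]`, `Λ = max s₁ 0`, transported into `V`
  set Λ : ℝ := max s₁ 0 with hΛ
  have hΛ0 : (0 : ℝ) ≤ Λ := le_max_right _ _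
  obtain ⟨K, hK, hKconn, hKproj⟩ := exists_isConnected_zeros_of_bilin_coercive B hB_pos hVfc hΛ0
    (fun s _ x hx => hcoer s x hx)
  set θ : ℝ × W → (↥S → EuclideanSpace ℂ d) := fun p => emb p.1 p.2 with hθ
  have hθV : ∀ p ∈ K, θ p ∈ V := by
    intro p hp
    obtain ⟨-, hz⟩ := hK hp
    exact hembV p.1 p.2 (congrArg Subtype.val hz)
  have hK'conn : IsPreconnected (θ '' K) := (hKconn.image θ hembc.continuousOn).isPreconnected
  have hK'V : θ '' K ⊆ V := by
    rintro _ ⟨p, hp, rfl⟩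
    exact hθV p hp
  -- points of `K` at winds `Λ` and `0`
  have hpt : ∀ t ∈ Icc 0 Λ, ∃ p ∈ K, p.1 = t := by
    intro t ht
    rw [← hKproj] at ht
    obtain ⟨p, hp, rfl⟩ := ht
    exact ⟨p, hp, rfl⟩
  obtain ⟨pΛ, hpΛ, hpΛ1⟩ := hpt Λ ⟨hΛ0, le_rfl⟩
  obtain ⟨p0, hp0, hp01⟩ := hpt 0 ⟨le_rfl, hΛ0⟩
  have hsub : θ '' K ⊆ connectedComponentIn V (θ pΛ) :=
    hK'conn.subset_connectedComponentIn (mem_image_of_mem θ hpΛ) hK'V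
  have hc0 : θ p0 ⟨0, h0⟩ = 0 := by
    show emb p0.1 p0.2 ⟨0, h0⟩ = 0
    rw [hemb0, hp01, Complex.ofReal_zero, zero_smul]
  refine ⟨θ pΛ, hθV pΛ hpΛ, ⟨Λ, le_max_left _ _, (forall_coe_eq_zero_iff h0).2 ?_⟩,
    θ p0, hsub (mem_image_of_mem θ hp0), (forall_coe_eq_zero_iff h0).2 hc0,
    hEnergy _ (hθV p0 hp0) hc0⟩
  show emb pΛ.1 pΛ.2 ⟨0, h0⟩ = (Λ : ℂ) • E
  rw [hemb0, hpΛ1]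

/-! ## §2 The cyclic force: the stub's matrix at every `(ν, N)` with `E(ν) = 3/(4π²ν)²` -/

/-- **The force coefficients of the cyclic force have `ℓ²` mass at most `3` on every finite frequency
set**: `Σ_{k ∈ T} ‖ĝ_k‖² ≤ ∫ ‖f‖² ≤ 3` (Bessel, from Parseval `hasSum_sq_norm_mFourierCoeff_complexify`, and
`|sin| ≤ 1` coordinatewise; the exact value `Σ_{ℤ³} ‖ĝ_k‖² = 3/2` is not needed here). [folklore] -/
theorem sum_norm_sq_cycForceCoeff_le (T : Finset (Fin 3 → ℤ)) :
    ∑ k ∈ T, ‖UnitAddTorus.mFourierCoeff (EuclideanSpace.complexify ∘ fun x : UnitAddTorus (Fin 3) =>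
      !₂[(fourier 1 (x 2) : ℂ).im, (fourier 1 (x 0) : ℂ).im, (fourier 1 (x 1) : ℂ).im]) k‖ ^ 2 ≤ 3 := by
  have hf := WindLineCyclic.isSmooth_cycForce
  have hPars := hasSum_sq_norm_mFourierCoeff_complexify (hf.memLp 2)
  refine (sum_le_hasSum T (fun k _ => sq_nonneg _) hPars).trans ?_
  have him : ∀ t : UnitAddCircle, ‖(fourier 1 t : ℂ).im‖ ^ 2 ≤ 1 := by
    intro t
    have h1 : |(fourier 1 t : ℂ).im| ≤ 1 := by
      have := Complex.abs_im_le_norm (fourier 1 t : ℂ)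
      simpa using this
    have h2 : |(fourier 1 t : ℂ).im| ^ 2 ≤ 1 ^ 2 := pow_le_pow_left₀ (abs_nonneg _) h1 2
    rw [Real.norm_eq_abs]
    simpa using h2
  have hpt : ∀ x : UnitAddTorus (Fin 3),
      ‖(!₂[(fourier 1 (x 2) : ℂ).im, (fourier 1 (x 0) : ℂ).im, (fourier 1 (x 1) : ℂ).im] :
        EuclideanSpace ℝ (Fin 3))‖ ^ 2 ≤ 3 := by
    intro x
    rw [EuclideanSpace.norm_sq_eq, Fin.sum_univ_three]
    have h2 := him (x 2)
    have h0 := him (x 0)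
    have h1 := him (x 1)
    simp only [Matrix.cons_val_zero, Matrix.cons_val_one, Matrix.cons_val_two, Matrix.head_cons,
      Matrix.tail_cons] at *
    linarith
  calc ∫ x, ‖(fun x : UnitAddTorus (Fin 3) =>
          (!₂[(fourier 1 (x 2) : ℂ).im, (fourier 1 (x 0) : ℂ).im, (fourier 1 (x 1) : ℂ).im] :
            EuclideanSpace ℝ (Fin 3))) x‖ ^ 2
        ≤ ∫ _ : UnitAddTorus (Fin 3), (3 : ℝ) :=
          integral_mono ((hf.memLp 2).integrable_norm_pow two_ne_zero) (integrable_const _)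
            fun x => hpt x
    _ = 3 := by simp

/-- **The provable (ν-dependent) core of `stub_boundedCalmStateFromShore`.** For the cyclic force
`f = (sin 2πx₃, sin 2πx₁, sin 2πx₂)` and the wind direction `e = (1, √2, √3)`: at EVERY viscosity `ν > 0` and
EVERY resolution `N`, for every wind threshold `s₁` the windy steady Galerkin variety `V` on `freqBall N`
contains a state `a` of wind `≥ s₁` whose connected component in `V` contains a CALM steady state `c`
(`c 0 = 0`) of total energy `Σ_k ‖c_k‖² ≤ 3 / (4π²ν)²`. This is the matrix of the registered stub with the
quantifier order `∀ ν ∃ E` instead of `∃ E ∀ ν < ν₀`: the stub asks for `sup_ν E(ν) < ∞` (a ν-UNIFORM energy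
cap on some calm state of the far-shore component), which is the open continuation bet and is NOT proved
here. (`exists_calm_in_component_of_wind_ge` with `g = ĝ|_S ∈ galerkinSubspace S`, `ĝ 0 = 0` by zero mean,
and `Σ_{k∈S} ‖ĝ_k‖² ≤ 3`.) [folklore] -/
theorem calmStateFromShore_apriori :
    ∀ ν : ℝ, 0 < ν → ∀ (N : ℕ) (S : Finset (Fin 3 → ℤ)), S = Literature.Analysis.FunctionSpaces.Torus.freqBall N → ∀ V : Set (↥S → EuclideanSpace ℂ (Fin 3)), V = {c | c ∈ Literature.Analysis.FluidPDE.galerkinSubspace S ∧ (∃ s : ℝ, ∀ k : ↥S, (k : Fin 3 → ℤ) = 0 → c k = (s : ℂ) • !₂[(1 : ℂ), ((Real.sqrt 2 : ℝ) : ℂ), ((Real.sqrt 3 : ℝ) : ℂ)]) ∧ Literature.Analysis.FluidPDE.galerkinRHS S ν (fun k : ↥S => UnitAddTorus.mFourierCoeff (Literature.Analysis.FunctionSpaces.EuclideanSpace.complexify ∘ fun x : UnitAddTorus (Fin 3) => !₂[(fourier 1 (x 2) : ℂ).im, (fourier 1 (x 0) : ℂ).im, (fourier 1 (x 1) : ℂ).im])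 (k : Fin 3 → ℤ)) c = 0} → ∀ s₁ : ℝ, ∃ a ∈ V, (∃ s : ℝ, s₁ ≤ s ∧ ∀ k : ↥S, (k : Fin 3 → ℤ) = 0 → a k = (s : ℂ) • !₂[(1 : ℂ), ((Real.sqrt 2 : ℝ) : ℂ), ((Real.sqrt 3 : ℝ) : ℂ)]) ∧ ∃ c ∈ connectedComponentIn V a, (∀ k : ↥S, (k : Fin 3 → ℤ) = 0 → c k = 0) ∧ ∑ k : ↥S, ‖c k‖ ^ 2 ≤ 3 / (4 * Real.pi ^ 2 * ν) ^ 2 := by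
  intro ν hν N S hS V hV s₁
  have hSsym : ∀ k ∈ S, -k ∈ S := by
    subst hS
    exact neg_mem_freqBall_of_mem
  have h0 : (0 : Fin 3 → ℤ) ∈ S := by
    subst hS
    exact zero_mem_freqBall N
  -- the literal direction is the complexified real direction `e = (1, √2, √3)`
  have he : (!₂[(1 : ℂ), ((Real.sqrt 2 : ℝ) : ℂ), ((Real.sqrt 3 : ℝ) : ℂ)] : EuclideanSpace ℂ (Fin 3)) =
      EuclideanSpace.complexify (!₂[(1 : ℝ), Real.sqrt 2, Real.sqrt 3] : EuclideanSpace ℝ (Fin 3)) := by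
    ext i
    fin_cases i <;> simp [EuclideanSpace.complexify_apply]
  -- the force vector lies in the phase space and has no mean mode
  have hf := WindLineCyclic.isSmooth_cycForce
  have hg : (fun k : ↥S => UnitAddTorus.mFourierCoeff (EuclideanSpace.complexify ∘ fun x : UnitAddTorus (Fin 3) =>
      !₂[(fourier 1 (x 2) : ℂ).im, (fourier 1 (x 0) : ℂ).im, (fourier 1 (x 1) : ℂ).im]) (k : Fin 3 → ℤ)) ∈
      galerkinSubspace S :=
    ⟨isRealCoeff_mFourierCoeff hf.integrable,
      isSolenoidalCoeff_restrict (WindLineCyclic.isDivFree_cycForce.isTransversal_mFourierCoeff hf S)⟩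
  have hg0 : (fun k : ↥S => UnitAddTorus.mFourierCoeff (EuclideanSpace.complexify ∘ fun x : UnitAddTorus (Fin 3) =>
      !₂[(fourier 1 (x 2) : ℂ).im, (fourier 1 (x 0) : ℂ).im, (fourier 1 (x 1) : ℂ).im]) (k : Fin 3 → ℤ))
        ⟨0, h0⟩ = 0 := by
    show UnitAddTorus.mFourierCoeff _ 0 = 0
    rw [mFourierCoeff_eq_integral_volume]
    simp only [neg_zero, UnitAddTorus.mFourier_zero, ContinuousMap.one_apply, one_smul, Function.comp_apply]
    have hz : ∫ x : UnitAddTorus (Fin 3),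
        (!₂[(fourier 1 (x 2) : ℂ).im, (fourier 1 (x 0) : ℂ).im, (fourier 1 (x 1) : ℂ).im] :
          EuclideanSpace ℝ (Fin 3)) = 0 :=
      WindLineCyclic.hasZeroMean_cycForce
    have hcomm := EuclideanSpace.complexify.integral_comp_comm (μ := (volume : Measure (UnitAddTorus (Fin 3))))
      (fun x : UnitAddTorus (Fin 3) =>
        (!₂[(fourier 1 (x 2) : ℂ).im, (fourier 1 (x 0) : ℂ).im, (fourier 1 (x 1) : ℂ).im] :
          EuclideanSpace ℝ (Fin 3)))
    rw [hcomm, hz, map_zero]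
  rw [he] at hV
  obtain ⟨a, haV, ⟨s, hs, has⟩, c, hc, hcalm, hE⟩ :=
    exists_calm_in_component_of_wind_ge hSsym h0 hg hg0 _ hν hV s₁
  refine ⟨a, haV, ⟨s, hs, ?_⟩, c, hc, hcalm, hE.trans ?_⟩
  · rw [he]
    exact has
  · refine div_le_div_of_nonneg_right ?_ (sq_nonneg _)
    rw [Finset.sum_coe_sort S (fun k : Fin 3 → ℤ => ‖UnitAddTorus.mFourierCoeff
      (EuclideanSpace.complexify ∘ fun x : UnitAddTorus (Fin 3) =>
        !₂[(fourier 1 (x 2) : ℂ).im, (fourier 1 (x 0) : ℂ).im, (fourier 1 (x 1) : ℂ).im]) k‖ ^ 2)]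
    exact sum_norm_sq_cycForceCoeff_le S

end Summit.AnomalousDissipation.AnomalousDissipation.Theorems.CyclicWindLineLoud.CalmFromShore

end
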